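import Summits.BirchSwinnertonDyer.Rank1Residual.AdditivePotMult.QuadraticBaseChangeRegulatorRankOne
import HarnessLib

/-!
# Route `CMKolyvaginAtInertTwo`, crux `CMKolyvaginExactAtInertTwo` (stmt-BirchSwinnertonDyer-24277):
# THE COUNT IDENTITY `#Ш(E/K)[2^∞] = #Ш(E/ℚ)[2^∞] · #Ш(E^{(d_K)}/ℚ)[2^∞]`, II —
# torsion: `#E'(K)_tors = #E(ℚ)_tors · #E_d(ℚ)_tors` EXACTLY when `E(K)` has no point of order `2`

Seat `bsd-line-cmk2-p1` g15 (cell `bsd-print-cf2`); helper (`--supports stmt-BirchSwinnertonDyer-24277`).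
THEOREMS ONLY: no definition, no named fact, no `sorry`; no item is closed; BSD is not proved by this.

The cell `b2b-bsdres` toolkit gives the ODD part
(`padicValNat_torsionOrder_baseChange_quadratic_of_odd`: `v_p(#W'(K)_tors) = v_p(#W(ℚ)_tors) +
v_p(#Wd(ℚ)_tors)` for odd `p`, any models `Wd ≅ W^{(d_K)}`, `W' ≅ W_K`). At `p = 2` there is no
identity in general (`E(K)[2] ⊇ E(ℚ)[2] = E^{(d)}(ℚ)[2]`); on the habitat of the crux (`ρ̄_{E,2}`
onto and `[K:ℚ] = 2`, so `E(K)[2] = 0`) all three `2`-parts are trivial, because `E(ℚ)` and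
`E^{(d_K)}(ℚ)` inject into `E(K)` (`QuadraticDescent.incl`, `twistMap`). Hence the exact product.

* `odd_natCard_of_forall_two_nsmul` — a finite abelian group without elements of order `2` has odd
  order (Cauchy);
* `forall_two_nsmul_of_injective` — "no `2`-torsion" descends along injective homomorphisms;
* `odd_torsionOrder_of_forall_two_nsmul`, `odd_torsionOrder_rat_of_forall_two_nsmul_baseChange`,
  `odd_torsionOrder_twist_of_forall_two_nsmul_baseChange`, `odd_torsionOrder_model_of_…` — the three
  torsion orders are odd when `W(K)` has no point of order `2`;
* `torsionOrder_baseChange_quadratic_eq_mul_of_forall_two_nsmul` —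
  **`#W'(K)_tors = #W(ℚ)_tors · #Wd(ℚ)_tors`**.

References: Silverman *AEC* Ex. 10.16, 10.22 (c); Dokchitser–Dokchitser 2010 Lemma 4.14.
-/

-- single-conjunct summit: `Summit.BirchSwinnertonDyer.BirchSwinnertonDyer.…` repeats the name by design
set_option linter.dupNamespace false
set_option autoImplicit false

noncomputable section

open scoped Classical

-- The tree's point-group lemmas over a general field `F` carry the classical `DecidableEq F` inside
-- their statements; specialised to `F = ℚ` they would meet Mathlib's `instDecidableEqRat`. Proofs that
-- handle `ℚ`-points therefore start with `letI : DecidableEq ℚ := classical` (term-local, no attribute),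
-- as in `AdditivePotMult.QuadraticBaseChangeRegulatorAnyRank`.

open WeierstrassCurve Literature.NumberTheory.EllipticCurves
  Literature.NumberTheory.EllipticCurves.KrizLi2019 Literature.NumberTheory.QuadraticFields
  Summit.BirchSwinnertonDyer.Rank1Residual.AdditivePotMult

namespace Summit.BirchSwinnertonDyer.BirchSwinnertonDyer.Theorems.ShaCountTwo

universe u v

/-! ## §1 Group theory: no element of order `2` ⟹ odd order -/

/-- A finite subgroup `H` of an abelian group in which `2 • x = 0 ⟹ x = 0` has ODD order (Cauchy:
an even order would give an element of order `2`). [folklore] -/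
theorem odd_natCard_of_forall_two_nsmul {G : Type u} [AddCommGroup G] (H : AddSubgroup G)
    [Finite H] (h : ∀ x ∈ H, (2 : ℕ) • x = 0 → x = 0) : Odd (Nat.card H) := by
  rw [← Nat.not_even_iff_odd]
  intro heven
  haveI : Fact (Nat.Prime 2) := ⟨Nat.prime_two⟩
  obtain ⟨x, hx⟩ := exists_prime_addOrderOf_dvd_card' (G := H) 2 (even_iff_two_dvd.mp heven)
  have h2x : (2 : ℕ) • (x : G) = 0 := by
    have := addOrderOf_nsmul_eq_zero x
    rw [hx] at this
    exact_mod_cast congrArg Subtype.val this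
  have hx0 : (x : G) = 0 := h x x.2 h2x
  have : x = 0 := Subtype.ext hx0
  rw [this, addOrderOf_zero] at hx
  exact absurd hx (by norm_num)

/-- "No `2`-torsion" descends along an injective additive map. [folklore] -/
theorem forall_two_nsmul_of_injective {A : Type u} {B : Type v} [AddCommGroup A] [AddCommGroup B]
    (f : A →+ B) (hf : Function.Injective f) (hB : ∀ y : B, (2 : ℕ) • y = 0 → y = 0) :
    ∀ x : A, (2 : ℕ) • x = 0 → x = 0 := by
  intro x hx
  apply hf
  rw [map_zero]
  exact hB (f x) (by rw [← map_nsmul, hx, map_zero])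

/-! ## §2 The three torsion orders are odd when `W(K)` has no point of order `2` -/

section Odd

variable {F : Type} [Field F] [NumberField F] (V : WeierstrassCurve F)

omit [NumberField F] in
/-- `#V(F)_tors` is odd if `V(F)` has no point of order `2`, for a Weierstrass curve over a number
field (the torsion subgroup is finite, `finite_torsion_holds`). [folklore] -/
theorem odd_torsionOrder_of_forall_two_nsmul [NumberField F] [V.IsElliptic]
    (h : ∀ P : V.toAffine.Point, (2 : ℕ) • P = 0 → P = 0) : Odd V.torsionOrder := by
  haveI := V.finite_torsion_holds
  exact odd_natCard_of_forall_two_nsmul (AddCommGroup.torsion V.toAffine.Point) fun x _ hx => h x hx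

end Odd

section Three

variable (W : WeierstrassCurve ℚ) [W.IsElliptic] (K : Type) [Field K] [NumberField K]
  (h2 : Module.finrank ℚ K = 2) (Wd : WeierstrassCurve ℚ) [Wd.IsElliptic]
  (hWd : ∃ C : VariableChange ℚ, C • W.quadraticTwist (NumberField.discr K : ℚ) = Wd)
  (W' : WeierstrassCurve K) [W'.IsElliptic] (hW' : ∃ C : VariableChange K, C • W.baseChange K = W')
  (h2t : ∀ P : (W.baseChange K).toAffine.Point, (2 : ℕ) • P = 0 → P = 0)

include h2t in
/-- `W(ℚ)` has no point of order `2` if `W(K)` has none (`QuadraticDescent.incl` is injective), so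
`#W(ℚ)_tors` is odd. [cite: SilvermanAEC2009, Exercise 10.16] -/
theorem odd_torsionOrder_rat_of_forall_two_nsmul_baseChange : Odd W.torsionOrder := by
  letI : DecidableEq ℚ := fun a b => Classical.propDecidable (a = b)
  exact odd_torsionOrder_of_forall_two_nsmul W
    (forall_two_nsmul_of_injective (QuadraticDescent.incl K W) (QuadraticDescent.incl_injective W) h2t)

omit [W.IsElliptic] in
include hW' h2t in
/-- A `K`-model `W' ≅ W_K` has no point of order `2` if `W(K)` has none (`VariableChange.pointEquiv`),
so `#W'(K)_tors` is odd. [folklore] -/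
theorem odd_torsionOrder_model_of_forall_two_nsmul_baseChange : Odd W'.torsionOrder := by
  obtain ⟨C', rfl⟩ := hW'
  set e := (VariableChange.pointEquiv (W.baseChange K) C').symm with he
  exact odd_torsionOrder_of_forall_two_nsmul (C' • W.baseChange K)
    (forall_two_nsmul_of_injective e.toAddMonoidHom e.injective h2t)

omit [W.IsElliptic] in
include h2 hWd h2t in
/-- A `ℚ`-model `Wd ≅ W^{(d_K)}` of the twist has no rational point of order `2` if `W(K)` has none:
`Wd(ℚ) ≅ W^{(c)}(ℚ)` (`d_K = c q²`, `K = ℚ(θ)`, `θ² = c`) injects into `W^{(1)}(K) ≅ W(K)` by the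
twist substitution `twistMap` (`twistMap_injective`); so `#Wd(ℚ)_tors` is odd.
[cite: SilvermanAEC2009, Exercise 10.16 and X.5 Cor. 5.4] -/
theorem odd_torsionOrder_twist_of_forall_two_nsmul_baseChange : Odd Wd.torsionOrder := by
  letI : DecidableEq ℚ := fun a b => Classical.propDecidable (a = b)
  haveI : NeZero (2 : ℚ) := ⟨two_ne_zero⟩
  obtain ⟨θ, c, hθ, hc⟩ := Quadratic.exists_sq_eq_algebraMap (F := ℚ) (K := K) h2
  obtain ⟨q, hq, hd⟩ := NumberField.exists_discr_eq_mul_sq h2 hθ hc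
  obtain ⟨C₁, hC₁⟩ := W.exists_variableChange_quadraticTwist_mul_sq c q hq
  rw [← hd] at hC₁
  obtain ⟨Cd, rfl⟩ := hWd
  obtain ⟨C, hC⟩ := W.exists_variableChange_quadraticTwist_one
  have hCK : C.map (algebraMap ℚ K) • W.baseChange K = (W.quadraticTwist 1).baseChange K := by
    rw [baseChange, baseChange, map_variableChange, hC]
  -- `Wd(ℚ) ≃ W^{(c)}(ℚ)`
  have e3 : (Cd • W.quadraticTwist (NumberField.discr K : ℚ)).toAffine.Point ≃+
      (W.quadraticTwist c).toAffine.Point :=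
    ((VariableChange.pointEquiv (W.quadraticTwist (NumberField.discr K : ℚ)) Cd).symm.trans
      (Affine.Point.congrEquiv hC₁.symm)).trans
      (VariableChange.pointEquiv (W.quadraticTwist c) C₁).symm
  -- `W^{(1)}(K) ≃ W(K)`
  have e2 : ((W.quadraticTwist 1).baseChange K).toAffine.Point ≃+ (W.baseChange K).toAffine.Point :=
    ((Affine.Point.congrEquiv hCK.symm).trans
      (VariableChange.pointEquiv (W.baseChange K) (C.map (algebraMap ℚ K))).symm)
  -- the injection `Wd(ℚ) → W(K)`
  set f : (Cd • W.quadraticTwist (NumberField.discr K : ℚ)).toAffine.Point →+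
      (W.baseChange K).toAffine.Point :=
    e2.toAddMonoidHom.comp ((QuadraticDescent.twistMap W hθ hc).comp e3.toAddMonoidHom) with hf
  have hfi : Function.Injective f := by
    rw [hf]
    exact e2.injective.comp ((QuadraticDescent.twistMap_injective W hθ hc).comp e3.injective)
  exact odd_torsionOrder_of_forall_two_nsmul _ (forall_two_nsmul_of_injective f hfi h2t)

/-! ## §3 The exact torsion identity -/

include h2 hWd hW' h2t in
/-- **`#W'(K)_tors = #W(ℚ)_tors · #Wd(ℚ)_tors` when `W(K)` has no point of order `2`** (`K`
quadratic, `Wd ≅ W^{(d_K)}`, `W' ≅ W_K` any models): the odd parts agree by the tree's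
`padicValNat_torsionOrder_baseChange_quadratic_of_odd` (Silverman *AEC* Ex. 10.16 / 10.22 (c)), and
all three orders are odd (§2). [cite: SilvermanAEC2009, Exercise 10.22 (c) and Exercise 10.16]
[cite: DokchitserDokchitserAnnals2010, proof of Lemma 4.14] -/
theorem torsionOrder_baseChange_quadratic_eq_mul_of_forall_two_nsmul :
    W'.torsionOrder = W.torsionOrder * Wd.torsionOrder := by
  have hK := odd_torsionOrder_model_of_forall_two_nsmul_baseChange W K W' hW' h2t
  have hQ := odd_torsionOrder_rat_of_forall_two_nsmul_baseChange W K h2t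
  have hD := odd_torsionOrder_twist_of_forall_two_nsmul_baseChange W K h2 Wd hWd h2t
  have h0' : W'.torsionOrder ≠ 0 := W'.torsionOrder_pos_holds.ne'
  have h0 : W.torsionOrder ≠ 0 := W.torsionOrder_pos_holds.ne'
  have h0d : Wd.torsionOrder ≠ 0 := Wd.torsionOrder_pos_holds.ne'
  rw [Nat.eq_iff_prime_padicValNat_eq _ _ h0' (mul_ne_zero h0 h0d)]
  intro p hp
  haveI : Fact p.Prime := ⟨hp⟩
  rw [padicValNat.mul h0 h0d]
  by_cases hp2 : p = 2
  · subst hp2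
    rw [padicValNat.eq_zero_of_not_dvd hK.not_two_dvd_nat,
      padicValNat.eq_zero_of_not_dvd hQ.not_two_dvd_nat,
      padicValNat.eq_zero_of_not_dvd hD.not_two_dvd_nat]
  · exact padicValNat_torsionOrder_baseChange_quadratic_of_odd W K h2 Wd hWd W' hW' p hp2

end Three

end Summit.BirchSwinnertonDyer.BirchSwinnertonDyer.Theorems.ShaCountTwo

end
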